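import Summits.BirchSwinnertonDyer.BirchSwinnertonDyer.Theorems.SignedBaseChangeAnticyclotomicEisensteinDivisibilityOfStubsAdmdefV15
import Summits.BirchSwinnertonDyer.BirchSwinnertonDyer.Theorems.SignedBaseChangeAnticyclotomicEisensteinDivisibilityAdmdefUnitLambdaOfLoc
import HarnessLib

/-!
# Line `admdef` v16: the ROOT DICHOTOMY wired into the composition — Howard's criterion [NV] is KERNEL whenever the
# bottom class of the `+` system is visible at one admissible Frobenius, so the research stub (Anch±) is asked ONLY on
# the «Heegner class dies mod p» locus (crux `AnticyclotomicEisensteinDivisibility`, stmt-BirchSwinnertonDyer-20727;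
# LEAD seat bsd-line-sbc-p1 gen 21, `--supports stmt-BirchSwinnertonDyer-20727`)

WHY THIS FILE.  On cell β (`N` not square-free, `E[p]` ramified at every `q ∣ N`, `p ∤ h_K`) the line `admdef` (skeleton of
record v15) reaches the crux through CHKLL25 Thm. 7.5, whose equality clause needs [NV] = `B.HasUnitLambda N` for the `+`
signed bipartite system `B` delivered (BY NAME, cite conjunct (16)) together with a Castella–Wan BDP frame, a transfer class
`z` and the weighted definite dictionary; v15 obtains [NV] from (Par) + W. Zhang's walk + the research stub (Anch±) (Brandt
data with non-zero weighted toric period at EVERY odd zero vertex carrying both signs) + the BRIDGE (b).  LEAD gen 19 proved,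
but did not wire in, the PRIMITIVE-ROOT CRITERION `…AdmdefUnitLambdaOfLoc.hasUnitLambda_of_limitBaseClass_res_ne_zero`:
[NV] holds as soon as the bottom component `z_{0,1} ∈ H¹(K, E[p])` of the limit base class restricts NON-trivially to `⟨φ⟩`
for ONE Frobenius `φ ∈ D_𝔓 ∩ Gal(K̄/K_∞)` at ONE prime over ONE `1`-admissible `q` (second reciprocity law at the root, read
modulo `𝔪`).  THIS FILE wires it in:

* `hasUnitLambda_of_rootDichotomy` — for a `+` system `B` with limit base class `z` and the bridge clause (b) («property `P`
  at an odd Zhang-admissible level ⟹ `λ_1(∏ s)(0) ∈ ℤ_pˣ`»): EITHER some admissible Frobenius sees `z_{0,1}` (then [NV] by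
  the root criterion, no anchor), OR `z_{0,1}` is invisible at every admissible Frobenius — and then it suffices that the walk
  produces an odd admissible level with `P` FROM THAT INVISIBILITY.  Pure logic over the two kernel inputs.
* `bipartiteNV_text_of_bridge_of_anchorNP` — the line's [NV]♯ text (frame, transfer class, `+` system at it, `HasUnitLambda`;
  cell line dropped) FROM the v14/v15 BRIDGE text, the two parity facts (Cassels–Tate, Dokchitser–Dokchitser: (Par) via
  `…AdmdefOddSelmerDim`) and the NEW, STRICTLY WEAKER research text (Anch±)_NP = (Anch±) asked only under the hypothesis
  (NP): «some PINNED `+` tuple (embedding datum, non-split datum at `𝔭`, Castella–Wan BDP frame `IsCWBDPLFunction`, transfer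
  class with `TransferInputs`, `+` system with that limit base class) has bottom class invisible at every admissible
  Frobenius».  The pinning (frame + transfer inputs) is what makes (NP) a genuine condition on `(E, K, p)` — by frame
  concordance the class is Castella–Wan's `+` Heegner class up to units, whose bottom layer is `δ_K(−2·y_K)`
  (`…AdmdefUnitLambdaOfHeegnerRoot`), so (NP) says «`y_K ∈ p·E(K)` seen at admissible primes»: Howard's NON-primitive case.
* (sibling census file `Theorems/…OfStubsAdmdefV16.lean`: the crux BY NAME from the four v16 stub texts — cite ×16 · S1∣ at
  `p ∣ h_K` · (Anch±)_NP · γ′.)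
* `anchorNP_of_anchor` — conservativity: the v15 text (Anch±) implies (Anch±)_NP (the reshape asks strictly less).

HONEST FRAMING: kernel glue over typed predicates and the sixteen cited facts taken as hypotheses (CONDITIONAL, audit
`proof.conditional`); (Anch±)_NP remains RESEARCH (rank-0 `℘`-converse / BSD unit for the non-ordinary level-raised forms at
non-square-free level, now only in the `p`-divisible-Heegner-point case); no Brandt module is computed; BSD / the crux /
[NV] are NOT proved by this file.

References: [cite: CastellaEtAl2025, Thm. 7.4 (second law), (7.2), Thm. 7.5, §7.4 (arXiv:2308.10474v2 p0030 L50–L62, p0031 L1–L30, p0033)]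
[cite: Howard2006, Thm. 3.2.3 (c), §3.2 (16)] [cite: BurungaleCastellaKim2021, arXiv:1908.09512 Prop. 7.4 and Lem. 7.6]
[cite: WZhang2014, Thm. 9.1 (proof), Lemma 7.3] [cite: CastellaWan2023, Prop. 4.4, §6 (MS pp. 20–31)] [cite: GrossKolyvagin1991, §2].
-/

-- D-0017: single-problem summit, the namespace repeats the problem name by design.
set_option linter.dupNamespace false
set_option autoImplicit false

noncomputable section

open scoped Classical NumberField

open NumberField IsDedekindDomain Field
  Literature.NumberTheory.EllipticCurves Literature.NumberTheory.EllipticCurves.ModularForms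
  Literature.NumberTheory.EllipticCurves.Rank1Residual Literature.NumberTheory.EllipticCurves.Castella2018
  Literature.NumberTheory.EllipticCurves.CastellaWan2024 Literature.NumberTheory.GaloisRepresentations
  Literature.NumberTheory.EllipticCurves.YanZhu2026 Literature.NumberTheory.Automorphic
  Summit.BirchSwinnertonDyer.Rank1Residual.X11b Summit.BirchSwinnertonDyer.Rank1Residual.X11b.Halves
  Summit.BirchSwinnertonDyer.BirchSwinnertonDyer.Theorems
open Literature.NumberTheory.EllipticCurves.AcSigned Literature.NumberTheory.EllipticCurves.CastellaHsuKunduLeeLiu2025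
  Literature.NumberTheory.EllipticCurves.BertoliniDarmon2005 Literature.NumberTheory.EllipticCurves.IwasawaDual
open WeierstrassCurve (geomTorsion)

namespace Summit.BirchSwinnertonDyer.BirchSwinnertonDyer.Theorems.SignedBaseChangeAcDivAdmdefRootDichotomy

open Summit.BirchSwinnertonDyer.BirchSwinnertonDyer.Theses.SignedBaseChange
open Summit.BirchSwinnertonDyer.BirchSwinnertonDyer.Theorems

/-! ## §1 The dichotomy at the root (pure logic over the root criterion and the walk) -/

section Dichotomy

variable {K : Type} [Field K] [NumberField K] {W : WeierstrassCurve ℚ} [W.IsGloballyMinimal] {p : ℕ} [Fact p.Prime]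
  {κ : ZpExtension K p} {γ : absoluteGaloisGroup K} {N : ℕ} {B : SignedBipartiteSystem W K p κ}

/-- **The ROOT DICHOTOMY for Howard's criterion.**  Let `B` be a `+` signed bipartite system at level `N` (CHKLL25 Thm. 7.4 as typed)
with limit base class `z` ((7.2)), let `P` be any property of the definite level, and assume the bridge clause (b): «`P (∏ s)` at an
odd Zhang-admissible level `s` ⟹ `λ⁺_1(∏ s)(0) ∈ ℤ_pˣ`».  If, ASSUMING the bottom class `z_{0,1} ∈ H¹(K, E[p])` restricts to zero on
`⟨φ⟩` for every Frobenius `φ ∈ Gal(K̄/K_∞) ∩ D_𝔓` at every prime `𝔓` over every `1`-admissible `q`, some odd Zhang-admissible level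
with `P` exists (the walk fed by the NON-primitive anchor), then `B.HasUnitLambda N` — because in the other case the second
reciprocity law at the root already gives `λ⁺_1(q)(0) ∈ ℤ_pˣ` (`…AdmdefUnitLambdaOfLoc.hasUnitLambda_of_limitBaseClass_res_ne_zero`,
Howard's primitive case).  [cite: CastellaEtAl2025, Thm. 7.4 second law, (7.2), Thm. 7.5 (arXiv:2308.10474v2 p0030 L50–L62, p0031 L17–L20)]
[cite: Howard2006, Thm. 3.2.3 (c)] [cite: BurungaleCastellaKim2021, arXiv:1908.09512 Lem. 7.6] -/
theorem hasUnitLambda_of_rootDichotomy (hB : IsSignedBipartiteSystem W K p κ γ N 1 B)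
    {z : Π n j : ℕ, (W.baseChange K).torsionH1Over ((p : ℤ) ^ j) (κ.layerSubgroup n)} (hz : B.IsLimitBaseClass z)
    (P : ℕ → Prop)
    (hb : ∀ s : Finset ℕ, IsZhangAdmissibleLevel N K (fun ℓ ↦ W.frobeniusTrace ℓ) p s → Odd s.card →
      P (∏ q ∈ s, q) → IsUnit (PowerSeries.constantCoeff (B.lam 1 (∏ q ∈ s, q))))
    (hwalk : (∀ (q : ℕ), IsAdmissiblePrime N K (fun ℓ ↦ W.frobeniusTrace ℓ) p 1 q →
        ∀ (v : HeightOneSpectrum (𝓞 K)), ((q : ℕ) : 𝓞 K) ∈ v.asIdeal →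
        ∀ 𝔓 ∈ v.primesAbove, ∀ (φ : absoluteGaloisGroup K) (hφ : φ ∈ κ.kerSubgroup),
          φ ∈ 𝔓.decompositionSubgroup (absoluteGaloisGroup K) → IsArithFrobAt (𝓞 K) φ 𝔓 →
          resOfLe (geomTorsion (W.baseChange K) ((p : ℤ) ^ 1))
            ((Subgroup.zpowers_le.mpr hφ).trans (κ.kerSubgroup_le_layerSubgroup 0)) (z 0 1) = 0) →
      ∃ s : Finset ℕ, IsZhangAdmissibleLevel N K (fun ℓ ↦ W.frobeniusTrace ℓ) p s ∧ Odd s.card ∧ P (∏ q ∈ s, q)) :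
    B.HasUnitLambda N := by
  by_cases hinv : ∀ (q : ℕ), IsAdmissiblePrime N K (fun ℓ ↦ W.frobeniusTrace ℓ) p 1 q →
      ∀ (v : HeightOneSpectrum (𝓞 K)), ((q : ℕ) : 𝓞 K) ∈ v.asIdeal →
      ∀ 𝔓 ∈ v.primesAbove, ∀ (φ : absoluteGaloisGroup K) (hφ : φ ∈ κ.kerSubgroup),
        φ ∈ 𝔓.decompositionSubgroup (absoluteGaloisGroup K) → IsArithFrobAt (𝓞 K) φ 𝔓 →
        resOfLe (geomTorsion (W.baseChange K) ((p : ℤ) ^ 1))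
          ((Subgroup.zpowers_le.mpr hφ).trans (κ.kerSubgroup_le_layerSubgroup 0)) (z 0 1) = 0
  · -- NON-primitive root: the walk (fed by the anchor) reaches an odd admissible level with `P`; bridge (b) gives the unit
    obtain ⟨s, hs, hodd, hP⟩ := hwalk hinv
    exact ⟨1, one_pos, ∏ q ∈ s, q, SignedBaseChangeAcDivAdmdefBipartiteNVLevelOne.prod_mem_defProducts_one hs hodd,
      hb s hs hodd hP⟩
  · -- PRIMITIVE root: some admissible Frobenius sees `z_{0,1}`; the second law at the root gives `λ_1(q)(0) ∈ ℤ_pˣ`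
    push Not at hinv
    obtain ⟨q, hq, v, hv, 𝔓, h𝔓, φ, hφ, hφD, hφF, hne⟩ := hinv
    exact (SignedBaseChangeAcDivAdmdefUnitLambdaOfLoc.hasUnitLambda_of_limitBaseClass_res_ne_zero hB hz hq hv h𝔓 hφ
      hφD hφF hne).2

end Dichotomy

/-! ## §2 [NV]♯ from the BRIDGE text, the two parity facts and the NON-primitive anchor text (Anch±)_NP -/

/-- **The line's [NV]♯ text (cell line dropped) FROM: the v14/v15 BRIDGE text, Cassels–Tate + Dokchitser–Dokchitser ((Par) via
`…AdmdefOddSelmerDim`), and the v16 research text (Anch±)_NP** — (Anch±) (Brandt data with non-zero WEIGHTED toric period at every odd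
zero vertex carrying both signs) asked ONLY under (NP): some pinned `+` tuple (embedding datum inducing `𝔭`, anticyclotomic `κ` with
topological generator, non-split datum at `𝔭`, Castella–Wan BDP frame, transfer class `z` with `TransferInputs (z, L)`, `+` system with
limit base class `z`) whose bottom class `z_{0,1}` restricts to zero on `⟨φ⟩` for every Frobenius `φ ∈ Gal(K̄/K_∞) ∩ D_𝔓`, `𝔓 ∣ v ∋ q`,
`q` `1`-admissible.  Proof: for the given non-split datum take the BRIDGE's tuple; `hasUnitLambda_of_rootDichotomy` with `P` = «Brandt
data with non-zero weighted period at level `(N, m)`»; in the non-primitive branch the tuple itself witnesses (NP), so (Anch±)_NP fires at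
every odd zero vertex with both signs and W. Zhang's walk + the signed detour (`…OfStubsAdmdefV14.exists_admissibleOddLevel_of_anchorSigned_of_split`,
(Par) from the two parity facts) supplies the level.  CONDITIONAL on the displayed texts; nothing about (Anch±)_NP is proved.
[cite: CastellaEtAl2025, Thm. 7.4, (7.2), Thm. 7.5, §7.4 (arXiv:2308.10474v2 pp. 30–33)] [cite: WZhang2014, Thm. 9.1 (proof)]
[cite: Howard2006, Thm. 3.2.3 (c)] [cite: DokchitserDokchitserAnnals2010, §4.6] -/
theorem bipartiteNV_text_of_bridge_of_anchorNP
    (hCT : ∀ (K : Type) [Field K] [NumberField K], WeierstrassCurve.exists_casselsTate_pairing (K := K))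
    (hDD : Literature.NumberTheory.EllipticCurves.dokchitser_selmerCorank_baseChange_mod_two_eq)
    (hBr : ∀ {p : ℕ} [Fact p.Prime] (ι : PadicAlgCl p ≃+* ℂ) (W : WeierstrassCurve ℚ) [W.IsElliptic]
      [W.IsGloballyMinimal] (K : Type) [Field K] [NumberField K]
      (𝔭 𝔭bar : HeightOneSpectrum (𝓞 K)) (κ : ZpExtension K p) (γ : absoluteGaloisGroup K)
      [hγF : Fact (κ.IsTopGenerator γ)] {N : ℕ} [NeZero N] {f : CuspForm (CongruenceSubgroup.Gamma0 N) 2}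
      (_ : IsNewformOf W f),
      (N : ℤ) = W.conductorNorm ℤ → 5 ≤ p → W.HasGoodReductionAtPrime p → W.frobeniusTrace p = 0 →
      Surj W p →
      IsImaginaryQuadratic K → ((Ideal.span {(p : ℤ)}).primesOver (𝓞 K)).ncard = 2 →
        (h𝔭 : ((p : ℕ) : 𝓞 K) ∈ 𝔭.asIdeal) →
        (∀ (w : InfinitePlace K) (k : 𝓞 K), k ∈ 𝔭.asIdeal ↔ ‖ι.symm (w.embedding (k : K))‖ < 1) →
        ((p : ℕ) : 𝓞 K) ∈ 𝔭bar.asIdeal → (hne : 𝔭bar ≠ 𝔭) →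
      (∀ ℓ : ℕ, ℓ.Prime → ℓ ∣ N → ((Ideal.span {(ℓ : ℤ)}).primesOver (𝓞 K)).ncard = 2) →
      IsCoprime (N : ℤ) (NumberField.discr K) → ¬ p ∣ NumberField.classNumber K →
      ¬ Squarefree N →
      (∀ q : ℕ, q.Prime → q ∣ N →
        ∃ v : HeightOneSpectrum (𝓞 ℚ), ((q : ℕ) : 𝓞 ℚ) ∈ v.asIdeal ∧
          ∃ 𝔓 ∈ v.primesAbove, ∃ σ ∈ 𝔓.inertia (absoluteGaloisGroup ℚ),
            ∃ P : W.geomTorsion (p : ℤ), σ • P ≠ P) →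
      κ.IsAnticyclotomic →
      ∀ (h𝔭ns : AcSigned.IsNonsplitIn κ 𝔭) (γ𝔭 : absoluteGaloisGroup (𝔭.adicCompletion K))
        (hγ𝔭 : κ (resGalOfEmb (closureEmb (K := K) (𝔭.adicCompletion K)) γ𝔭) = κ γ),
        ∃ (ΩK : ℂ) (Ωp : (unrIntegers p)ˣ) (L : UnrSeries p), ΩK ≠ 0 ∧
          IsCWBDPLFunction ι 𝔭 κ γ f (NumberField.discr K) ΩK ((Ωp : unrIntegers p) : ℂ_[p]) L ∧
          ∃ (z : AcSigned.selmerLambdaAdic (W.baseChange K) p κ γ (fun _ ↦ .sgn 1))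
            (B : CastellaHsuKunduLeeLiu2025.SignedBipartiteSystem W K p κ),
            AcSigned.TransferInputs (W.baseChange K) p κ γ hγF.out 𝔭 h𝔭ns γ𝔭 hγ𝔭 𝔭bar (fun h ↦ hne h.symm) h𝔭 1 z L ∧
            CastellaHsuKunduLeeLiu2025.IsSignedBipartiteSystem W K p κ γ N 1 B ∧ B.IsLimitBaseClass z.1 ∧
            ∀ s : Finset ℕ, IsZhangAdmissibleLevel N K (fun ℓ ↦ W.frobeniusTrace ℓ) p s → Odd s.card →
              (∃ (S : Brandt.XiSetup N (∏ q ∈ s, q)) (ψ : K →ₐ[ℚ] S.D) (I : Submodule ℤ S.D)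
                  (φ : Brandt.ClassSet S.O → ZMod p),
                  Brandt.IsGrossPoint S.O ψ I ∧
                  (letI : Fintype (Brandt.ClassSet S.O) := Fintype.ofFinite _
                   φ ∈ Brandt.eigenSpace (ZMod p) (N * ∏ q ∈ s, q) (Brandt.matrix S.O) (fun ℓ ↦ W.frobeniusTrace ℓ)) ∧
                  Brandt.toricPeriod S.O ψ I (fun i ↦ (Brandt.weight S.O i : ZMod p) * φ i) ≠ 0) →
              IsUnit (PowerSeries.constantCoeff (B.lam 1 (∏ q ∈ s, q))))
    (hAnch :
    ∀ {p : ℕ} [Fact p.Prime] (W : WeierstrassCurve ℚ) [W.IsElliptic] [W.IsGloballyMinimal]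
      (K : Type) [Field K] [NumberField K] {N : ℕ} [NeZero N] {f : CuspForm (CongruenceSubgroup.Gamma0 N) 2}
      (_ : IsNewformOf W f),
      (N : ℤ) = W.conductorNorm ℤ → 5 ≤ p → W.HasGoodReductionAtPrime p → W.frobeniusTrace p = 0 →
      Surj W p →
      IsImaginaryQuadratic K → ((Ideal.span {(p : ℤ)}).primesOver (𝓞 K)).ncard = 2 →
      (∀ ℓ : ℕ, ℓ.Prime → ℓ ∣ N → ((Ideal.span {(ℓ : ℤ)}).primesOver (𝓞 K)).ncard = 2) →
      IsCoprime (N : ℤ) (NumberField.discr K) → ¬ p ∣ NumberField.classNumber K →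
      ¬ Squarefree N →
      (∀ q : ℕ, q.Prime → q ∣ N →
        ∃ v : HeightOneSpectrum (𝓞 ℚ), ((q : ℕ) : 𝓞 ℚ) ∈ v.asIdeal ∧
          ∃ 𝔓 ∈ v.primesAbove, ∃ σ ∈ 𝔓.inertia (absoluteGaloisGroup ℚ),
            ∃ P : W.geomTorsion (p : ℤ), σ • P ≠ P) →
      -- (NP) [v16]: some PINNED `+` tuple whose bottom class is invisible at every admissible Frobenius
      (∃ (ι : PadicAlgCl p ≃+* ℂ) (𝔭 𝔭bar : HeightOneSpectrum (𝓞 K)) (κ : ZpExtension K p) (γ : absoluteGaloisGroup K)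
          (hγ : κ.IsTopGenerator γ) (h𝔭 : ((p : ℕ) : 𝓞 K) ∈ 𝔭.asIdeal) (hne : 𝔭bar ≠ 𝔭)
          (h𝔭ns : AcSigned.IsNonsplitIn κ 𝔭) (γ𝔭 : absoluteGaloisGroup (𝔭.adicCompletion K))
          (hγ𝔭 : κ (resGalOfEmb (closureEmb (K := K) (𝔭.adicCompletion K)) γ𝔭) = κ γ)
          (ΩK : ℂ) (Ωp : (unrIntegers p)ˣ) (L : UnrSeries p)
          (z : AcSigned.selmerLambdaAdic (W.baseChange K) p κ γ (fun _ ↦ .sgn 1))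
          (B : CastellaHsuKunduLeeLiu2025.SignedBipartiteSystem W K p κ),
          κ.IsAnticyclotomic ∧ (∀ (w : InfinitePlace K) (k : 𝓞 K), k ∈ 𝔭.asIdeal ↔ ‖ι.symm (w.embedding (k : K))‖ < 1) ∧
          ((p : ℕ) : 𝓞 K) ∈ 𝔭bar.asIdeal ∧ ΩK ≠ 0 ∧
          IsCWBDPLFunction ι 𝔭 κ γ f (NumberField.discr K) ΩK ((Ωp : unrIntegers p) : ℂ_[p]) L ∧
          AcSigned.TransferInputs (W.baseChange K) p κ γ hγ 𝔭 h𝔭ns γ𝔭 hγ𝔭 𝔭bar (fun h ↦ hne h.symm) h𝔭 1 z L ∧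
          CastellaHsuKunduLeeLiu2025.IsSignedBipartiteSystem W K p κ γ N 1 B ∧ B.IsLimitBaseClass z.1 ∧
          ∀ (q : ℕ), IsAdmissiblePrime N K (fun ℓ ↦ W.frobeniusTrace ℓ) p 1 q →
            ∀ (v : HeightOneSpectrum (𝓞 K)), ((q : ℕ) : 𝓞 K) ∈ v.asIdeal →
            ∀ 𝔓 ∈ v.primesAbove, ∀ (φ : absoluteGaloisGroup K) (hφ : φ ∈ κ.kerSubgroup),
              φ ∈ 𝔓.decompositionSubgroup (absoluteGaloisGroup K) → IsArithFrobAt (𝓞 K) φ 𝔓 →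
              resOfLe (geomTorsion (W.baseChange K) ((p : ℤ) ^ 1))
                ((Subgroup.zpowers_le.mpr hφ).trans (κ.kerSubgroup_le_layerSubgroup 0)) (z.1 0 1) = 0) →
      ∀ (c : K ≃ₐ[ℚ] K), c ≠ 1 → ∀ [Module (ZMod p) (AdditiveKoly.Vp W K p)],
        ∀ n : Finset (AdditiveKoly.AdmQ W K p), Odd n.card →
          (∀ s : Bool, ∃ q ∈ n, ∀ v : HeightOneSpectrum (𝓞 K), ((q : ℕ) : 𝓞 K) ∈ v.asIdeal → ∀ z : AdditiveKoly.Vp W K p,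
            (W.baseChange K).torsionLocMap (v.adicCompletion K) ((p ^ 1 : ℕ) : ℤ) (conjAct W c ((p ^ 1 : ℕ) : ℤ) z) =
              AdditiveKoly.sgnP s • (W.baseChange K).torsionLocMap (v.adicCompletion K) ((p ^ 1 : ℕ) : ℤ) z) →
          (∀ μ : Bool, AdditiveKoly.SelQP W K p c n μ = ⊥) →
          ∃ (S : Brandt.XiSetup N (∏ q ∈ n.image Subtype.val, q)) (ψ : K →ₐ[ℚ] S.D) (I : Submodule ℤ S.D)
            (φ : Brandt.ClassSet S.O → ZMod p),
            Brandt.IsGrossPoint S.O ψ I ∧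
            (letI : Fintype (Brandt.ClassSet S.O) := Fintype.ofFinite _
             φ ∈ Brandt.eigenSpace (ZMod p) (N * ∏ q ∈ n.image Subtype.val, q) (Brandt.matrix S.O) (fun ℓ ↦ W.frobeniusTrace ℓ)) ∧
            Brandt.toricPeriod S.O ψ I (fun i ↦ (Brandt.weight S.O i : ZMod p) * φ i) ≠ 0) :
    ∀ {p : ℕ} [Fact p.Prime] (ι : PadicAlgCl p ≃+* ℂ) (W : WeierstrassCurve ℚ) [W.IsElliptic]
      [W.IsGloballyMinimal] (K : Type) [Field K] [NumberField K]
      (𝔭 𝔭bar : HeightOneSpectrum (𝓞 K)) (κ : ZpExtension K p) (γ : absoluteGaloisGroup K)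
      [hγF : Fact (κ.IsTopGenerator γ)] {N : ℕ} [NeZero N] {f : CuspForm (CongruenceSubgroup.Gamma0 N) 2}
      (_ : IsNewformOf W f),
      (N : ℤ) = W.conductorNorm ℤ → 5 ≤ p → W.HasGoodReductionAtPrime p → W.frobeniusTrace p = 0 →
      Surj W p →
      IsImaginaryQuadratic K → ((Ideal.span {(p : ℤ)}).primesOver (𝓞 K)).ncard = 2 →
        (h𝔭 : ((p : ℕ) : 𝓞 K) ∈ 𝔭.asIdeal) →
        (∀ (w : InfinitePlace K) (k : 𝓞 K), k ∈ 𝔭.asIdeal ↔ ‖ι.symm (w.embedding (k : K))‖ < 1) →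
        ((p : ℕ) : 𝓞 K) ∈ 𝔭bar.asIdeal → (hne : 𝔭bar ≠ 𝔭) →
      (∀ ℓ : ℕ, ℓ.Prime → ℓ ∣ N → ((Ideal.span {(ℓ : ℤ)}).primesOver (𝓞 K)).ncard = 2) →
      IsCoprime (N : ℤ) (NumberField.discr K) → ¬ p ∣ NumberField.classNumber K →
      ¬ Squarefree N →
      (∀ q : ℕ, q.Prime → q ∣ N →
        ∃ v : HeightOneSpectrum (𝓞 ℚ), ((q : ℕ) : 𝓞 ℚ) ∈ v.asIdeal ∧
          ∃ 𝔓 ∈ v.primesAbove, ∃ σ ∈ 𝔓.inertia (absoluteGaloisGroup ℚ),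
            ∃ P : W.geomTorsion (p : ℤ), σ • P ≠ P) →
      κ.IsAnticyclotomic →
      ∀ (h𝔭ns : AcSigned.IsNonsplitIn κ 𝔭) (γ𝔭 : absoluteGaloisGroup (𝔭.adicCompletion K))
        (hγ𝔭 : κ (resGalOfEmb (closureEmb (K := K) (𝔭.adicCompletion K)) γ𝔭) = κ γ),
        ∃ (ΩK : ℂ) (Ωp : (unrIntegers p)ˣ) (L : UnrSeries p), ΩK ≠ 0 ∧
          IsCWBDPLFunction ι 𝔭 κ γ f (NumberField.discr K) ΩK ((Ωp : unrIntegers p) : ℂ_[p]) L ∧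
          ∃ (z : AcSigned.selmerLambdaAdic (W.baseChange K) p κ γ (fun _ ↦ .sgn 1))
            (B : CastellaHsuKunduLeeLiu2025.SignedBipartiteSystem W K p κ),
            AcSigned.TransferInputs (W.baseChange K) p κ γ hγF.out 𝔭 h𝔭ns γ𝔭 hγ𝔭 𝔭bar (fun h ↦ hne h.symm) h𝔭 1 z L ∧
            CastellaHsuKunduLeeLiu2025.IsSignedBipartiteSystem W K p κ γ N 1 B ∧ B.IsLimitBaseClass z.1 ∧ B.HasUnitLambda N := by
  intro p _ ι W _ _ K _ _ 𝔭 𝔭bar κ γ hγF N _ f hf hN hp hgood hap hsurj hK hsplit h𝔭 hι h𝔭bar hne hHeeg hcop hh hnsq hram hac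
    h𝔭ns γ𝔭 hγ𝔭
  obtain ⟨ΩK, Ωp, L, hΩ, hBDP, z, B, hTz, hB, hbase, hbridge⟩ :=
    hBr ι W K 𝔭 𝔭bar κ γ hf hN hp hgood hap hsurj hK hsplit h𝔭 hι h𝔭bar hne hHeeg hcop hh hnsq hram hac h𝔭ns γ𝔭 hγ𝔭
  refine ⟨ΩK, Ωp, L, hΩ, hBDP, z, B, hTz, hB, hbase, ?_⟩
  refine hasUnitLambda_of_rootDichotomy hB hbase
    (fun m ↦ ∃ (S : Brandt.XiSetup N m) (ψ : K →ₐ[ℚ] S.D) (I : Submodule ℤ S.D) (φ : Brandt.ClassSet S.O → ZMod p),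
      Brandt.IsGrossPoint S.O ψ I ∧
      (letI : Fintype (Brandt.ClassSet S.O) := Fintype.ofFinite _
       φ ∈ Brandt.eigenSpace (ZMod p) (N * m) (Brandt.matrix S.O) (fun ℓ ↦ W.frobeniusTrace ℓ)) ∧
      Brandt.toricPeriod S.O ψ I (fun i ↦ (Brandt.weight S.O i : ZMod p) * φ i) ≠ 0)
    hbridge fun hinv ↦ ?_
  -- NON-primitive root: the tuple at hand witnesses (NP), so the anchor fires at every odd zero vertex with both signs
  obtain ⟨c, hc1⟩ := AdditiveKoly.exists_algEquiv_ne_one_of_isImaginaryQuadratic K hK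
  letI : Module (ZMod p) (AdditiveKoly.Vp W K p) :=
    AddCommGroup.zmodModule (SignedBaseChangeAcDivOfStubsAdmdefV8.p_nsmul_vp_eq_zero' W K)
  exact SignedBaseChangeAcDivOfStubsAdmdefV14.exists_admissibleOddLevel_of_anchorSigned_of_split W K hN hp hsurj hK hHeeg
    hsplit hc1
    (SignedBaseChangeAcDivAdmdefOddSelmerDim.oddSelmerDim_of_casselsTate_of_dokchitser hCT hDD W K hN hp hsurj hK hHeeg c hc1)
    (fun m ↦ ∃ (S : Brandt.XiSetup N m) (ψ : K →ₐ[ℚ] S.D) (I : Submodule ℤ S.D) (φ : Brandt.ClassSet S.O → ZMod p),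
      Brandt.IsGrossPoint S.O ψ I ∧
      (letI : Fintype (Brandt.ClassSet S.O) := Fintype.ofFinite _
       φ ∈ Brandt.eigenSpace (ZMod p) (N * m) (Brandt.matrix S.O) (fun ℓ ↦ W.frobeniusTrace ℓ)) ∧
      Brandt.toricPeriod S.O ψ I (fun i ↦ (Brandt.weight S.O i : ZMod p) * φ i) ≠ 0)
    (hAnch W K hf hN hp hgood hap hsurj hK hsplit hHeeg hcop hh hnsq hram
        ⟨ι, 𝔭, 𝔭bar, κ, γ, hγF.out, h𝔭, hne, h𝔭ns, γ𝔭, hγ𝔭, ΩK, Ωp, L, z, B, hac, hι, h𝔭bar, hΩ, hBDP, hTz, hB, hbase,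
          hinv⟩ c hc1)

/-! ## §3 Conservativity: the v15 research text (Anch±) implies the v16 text (Anch±)_NP -/

/-- **Conservativity certificate of the v16 reshape**: the v15 registered text (Anch±) (`Signdetour.DefiniteAnchorSignedNS`, unfolded) implies the v16
text (Anch±)_NP — the hypothesis (NP) is simply discarded; the reshape asks STRICTLY LESS of the hands (orphan by design: a certificate, not a
composition edge). [folklore] -/
theorem anchorNP_of_anchor
    (hAnch :
    ∀ {p : ℕ} [Fact p.Prime] (W : WeierstrassCurve ℚ) [W.IsElliptic] [W.IsGloballyMinimal]
      (K : Type) [Field K] [NumberField K] {N : ℕ} [NeZero N] {f : CuspForm (CongruenceSubgroup.Gamma0 N) 2}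
      (_ : IsNewformOf W f),
      (N : ℤ) = W.conductorNorm ℤ → 5 ≤ p → W.HasGoodReductionAtPrime p → W.frobeniusTrace p = 0 →
      Surj W p →
      IsImaginaryQuadratic K → ((Ideal.span {(p : ℤ)}).primesOver (𝓞 K)).ncard = 2 →
      (∀ ℓ : ℕ, ℓ.Prime → ℓ ∣ N → ((Ideal.span {(ℓ : ℤ)}).primesOver (𝓞 K)).ncard = 2) →
      IsCoprime (N : ℤ) (NumberField.discr K) → ¬ p ∣ NumberField.classNumber K →
      ¬ Squarefree N →
      (∀ q : ℕ, q.Prime → q ∣ N →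
        ∃ v : HeightOneSpectrum (𝓞 ℚ), ((q : ℕ) : 𝓞 ℚ) ∈ v.asIdeal ∧
          ∃ 𝔓 ∈ v.primesAbove, ∃ σ ∈ 𝔓.inertia (absoluteGaloisGroup ℚ),
            ∃ P : W.geomTorsion (p : ℤ), σ • P ≠ P) →
      ∀ (c : K ≃ₐ[ℚ] K), c ≠ 1 → ∀ [Module (ZMod p) (AdditiveKoly.Vp W K p)],
        ∀ n : Finset (AdditiveKoly.AdmQ W K p), Odd n.card →
          (∀ s : Bool, ∃ q ∈ n, ∀ v : HeightOneSpectrum (𝓞 K), ((q : ℕ) : 𝓞 K) ∈ v.asIdeal → ∀ z : AdditiveKoly.Vp W K p,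
            (W.baseChange K).torsionLocMap (v.adicCompletion K) ((p ^ 1 : ℕ) : ℤ) (conjAct W c ((p ^ 1 : ℕ) : ℤ) z) =
              AdditiveKoly.sgnP s • (W.baseChange K).torsionLocMap (v.adicCompletion K) ((p ^ 1 : ℕ) : ℤ) z) →
          (∀ μ : Bool, AdditiveKoly.SelQP W K p c n μ = ⊥) →
          ∃ (S : Brandt.XiSetup N (∏ q ∈ n.image Subtype.val, q)) (ψ : K →ₐ[ℚ] S.D) (I : Submodule ℤ S.D)
            (φ : Brandt.ClassSet S.O → ZMod p),
            Brandt.IsGrossPoint S.O ψ I ∧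
            (letI : Fintype (Brandt.ClassSet S.O) := Fintype.ofFinite _
             φ ∈ Brandt.eigenSpace (ZMod p) (N * ∏ q ∈ n.image Subtype.val, q) (Brandt.matrix S.O) (fun ℓ ↦ W.frobeniusTrace ℓ)) ∧
            Brandt.toricPeriod S.O ψ I (fun i ↦ (Brandt.weight S.O i : ZMod p) * φ i) ≠ 0) :
    ∀ {p : ℕ} [Fact p.Prime] (W : WeierstrassCurve ℚ) [W.IsElliptic] [W.IsGloballyMinimal]
      (K : Type) [Field K] [NumberField K] {N : ℕ} [NeZero N] {f : CuspForm (CongruenceSubgroup.Gamma0 N) 2}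
      (_ : IsNewformOf W f),
      (N : ℤ) = W.conductorNorm ℤ → 5 ≤ p → W.HasGoodReductionAtPrime p → W.frobeniusTrace p = 0 →
      Surj W p →
      IsImaginaryQuadratic K → ((Ideal.span {(p : ℤ)}).primesOver (𝓞 K)).ncard = 2 →
      (∀ ℓ : ℕ, ℓ.Prime → ℓ ∣ N → ((Ideal.span {(ℓ : ℤ)}).primesOver (𝓞 K)).ncard = 2) →
      IsCoprime (N : ℤ) (NumberField.discr K) → ¬ p ∣ NumberField.classNumber K →
      ¬ Squarefree N →
      (∀ q : ℕ, q.Prime → q ∣ N →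
        ∃ v : HeightOneSpectrum (𝓞 ℚ), ((q : ℕ) : 𝓞 ℚ) ∈ v.asIdeal ∧
          ∃ 𝔓 ∈ v.primesAbove, ∃ σ ∈ 𝔓.inertia (absoluteGaloisGroup ℚ),
            ∃ P : W.geomTorsion (p : ℤ), σ • P ≠ P) →
      -- (NP) [v16]: some PINNED `+` tuple whose bottom class is invisible at every admissible Frobenius
      (∃ (ι : PadicAlgCl p ≃+* ℂ) (𝔭 𝔭bar : HeightOneSpectrum (𝓞 K)) (κ : ZpExtension K p) (γ : absoluteGaloisGroup K)
          (hγ : κ.IsTopGenerator γ) (h𝔭 : ((p : ℕ) : 𝓞 K) ∈ 𝔭.asIdeal) (hne : 𝔭bar ≠ 𝔭)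
          (h𝔭ns : AcSigned.IsNonsplitIn κ 𝔭) (γ𝔭 : absoluteGaloisGroup (𝔭.adicCompletion K))
          (hγ𝔭 : κ (resGalOfEmb (closureEmb (K := K) (𝔭.adicCompletion K)) γ𝔭) = κ γ)
          (ΩK : ℂ) (Ωp : (unrIntegers p)ˣ) (L : UnrSeries p)
          (z : AcSigned.selmerLambdaAdic (W.baseChange K) p κ γ (fun _ ↦ .sgn 1))
          (B : CastellaHsuKunduLeeLiu2025.SignedBipartiteSystem W K p κ),
          κ.IsAnticyclotomic ∧ (∀ (w : InfinitePlace K) (k : 𝓞 K), k ∈ 𝔭.asIdeal ↔ ‖ι.symm (w.embedding (k : K))‖ < 1) ∧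
          ((p : ℕ) : 𝓞 K) ∈ 𝔭bar.asIdeal ∧ ΩK ≠ 0 ∧
          IsCWBDPLFunction ι 𝔭 κ γ f (NumberField.discr K) ΩK ((Ωp : unrIntegers p) : ℂ_[p]) L ∧
          AcSigned.TransferInputs (W.baseChange K) p κ γ hγ 𝔭 h𝔭ns γ𝔭 hγ𝔭 𝔭bar (fun h ↦ hne h.symm) h𝔭 1 z L ∧
          CastellaHsuKunduLeeLiu2025.IsSignedBipartiteSystem W K p κ γ N 1 B ∧ B.IsLimitBaseClass z.1 ∧
          ∀ (q : ℕ), IsAdmissiblePrime N K (fun ℓ ↦ W.frobeniusTrace ℓ) p 1 q →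
            ∀ (v : HeightOneSpectrum (𝓞 K)), ((q : ℕ) : 𝓞 K) ∈ v.asIdeal →
            ∀ 𝔓 ∈ v.primesAbove, ∀ (φ : absoluteGaloisGroup K) (hφ : φ ∈ κ.kerSubgroup),
              φ ∈ 𝔓.decompositionSubgroup (absoluteGaloisGroup K) → IsArithFrobAt (𝓞 K) φ 𝔓 →
              resOfLe (geomTorsion (W.baseChange K) ((p : ℤ) ^ 1))
                ((Subgroup.zpowers_le.mpr hφ).trans (κ.kerSubgroup_le_layerSubgroup 0)) (z.1 0 1) = 0) →
      ∀ (c : K ≃ₐ[ℚ] K), c ≠ 1 → ∀ [Module (ZMod p) (AdditiveKoly.Vp W K p)],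
        ∀ n : Finset (AdditiveKoly.AdmQ W K p), Odd n.card →
          (∀ s : Bool, ∃ q ∈ n, ∀ v : HeightOneSpectrum (𝓞 K), ((q : ℕ) : 𝓞 K) ∈ v.asIdeal → ∀ z : AdditiveKoly.Vp W K p,
            (W.baseChange K).torsionLocMap (v.adicCompletion K) ((p ^ 1 : ℕ) : ℤ) (conjAct W c ((p ^ 1 : ℕ) : ℤ) z) =
              AdditiveKoly.sgnP s • (W.baseChange K).torsionLocMap (v.adicCompletion K) ((p ^ 1 : ℕ) : ℤ) z) →
          (∀ μ : Bool, AdditiveKoly.SelQP W K p c n μ = ⊥) →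
          ∃ (S : Brandt.XiSetup N (∏ q ∈ n.image Subtype.val, q)) (ψ : K →ₐ[ℚ] S.D) (I : Submodule ℤ S.D)
            (φ : Brandt.ClassSet S.O → ZMod p),
            Brandt.IsGrossPoint S.O ψ I ∧
            (letI : Fintype (Brandt.ClassSet S.O) := Fintype.ofFinite _
             φ ∈ Brandt.eigenSpace (ZMod p) (N * ∏ q ∈ n.image Subtype.val, q) (Brandt.matrix S.O) (fun ℓ ↦ W.frobeniusTrace ℓ)) ∧
            Brandt.toricPeriod S.O ψ I (fun i ↦ (Brandt.weight S.O i : ZMod p) * φ i) ≠ 0 := by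
  intro p _ W _ _ K _ _ N _ f hf hN hp hgood hap hsurj hK hsplit hHeeg hcop hh hnsq hram _hNP c hc1 _ n hodd hboth hzero
  exact hAnch W K hf hN hp hgood hap hsurj hK hsplit hHeeg hcop hh hnsq hram c hc1 n hodd hboth hzero

end Summit.BirchSwinnertonDyer.BirchSwinnertonDyer.Theorems.SignedBaseChangeAcDivAdmdefRootDichotomy

end
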